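import Literature.AlgebraicGeometry.Resolution.MarkedIdealsLemmas
import Mathlib.AlgebraicGeometry.IdealSheaf.Functorial
import Mathlib.AlgebraicGeometry.Fiber
import HarnessLib

/-!
# Reduced closed subschemes: radical ideal sheaves, fibres, and unions with disjoint supports

Topic: `Literature/AlgebraicGeometry/Resolution`. Elementary facts about the closed subscheme
`V(I)` of a quasi-coherent ideal sheaf `I` (Mathlib `Scheme.IdealSheafData.subscheme`) used to
control the scheme-theoretic fibres of a union of hypersurface sections (de Jong 1996, proof of
Lemma 4.13: "`H ∩ f⁻¹(y)` is a reduced scheme. Here `f⁻¹(y)` denotes the scheme-theoretic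
fibre"):

* `isReduced_subscheme_iff` — `V(I)` is reduced iff every `I(U)` is a radical ideal iff
  `I = √I` (`isReduced_subscheme_iff_radical_eq`), via Mathlib's affine cover of `V(I)` by the
  `Spec (Γ(X, U)/I(U))` (Görtz–Wedhorn I, Prop. 3.27 (1), p. 101: a scheme is reduced iff all
  rings of sections are; `A/𝔞` is reduced iff `𝔞` is radical);
* `isReduced_pullback_subschemeι_comp_iff` — the base change `V(I) ×_Y T` of `V(I) → X → Y`
  along `g : T → Y` is reduced iff the closed subscheme `V(I · 𝒪_{X ×_Y T})` of `X ×_Y T` is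
  (`V(I) ×_Y T ≅ V(I) ×_X (X ×_Y T)`, Mathlib `pullbackRightPullbackFstIso`, `comapIso`); in
  particular for the scheme-theoretic fibre at a point (`isReduced_fiber_subschemeι_comp_iff`);
* ideal sheaves with disjoint supports are comaximal (`sup_eq_top_of_disjoint_support`), so
  their product is their intersection (`mul_eq_inf_of_disjoint_support`), and **the product of
  radical ideal sheaves with pairwise disjoint supports is radical**
  (`radical_mul_eq_self_of_disjoint_support`, two and three factors);
* whence: if three closed subschemes `V(I₁)`, `V(I₂)`, `V(I₃)` of `X` have reduced base changes
  along `g : T → Y` and their supports are pairwise disjoint over `T`, then the base change of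
  `V(I₁ I₂ I₃)` is reduced (`isReduced_pullback_subschemeι_mul₃`), and the same for fibres at a
  point (`isReduced_fiber_subschemeι_mul₃`).

## References

* U. Görtz, T. Wedhorn, *Algebraic Geometry I: Schemes*, 2nd ed. (2020), Prop. 3.27 (1)
  (p. 101: reducedness on rings of sections), (4.11) with Example 4.36 (p. 139: inverse images
  of closed subschemes, `f⁻¹(V(𝔞)) = V(𝔞B)`). [GortzWedhorn2020]
* A. J. de Jong, *Smoothness, semi-stability and alterations*, Publ. Math. IHÉS 83 (1996),
  proof of Lemma 4.13, p. 70. [DeJong1996]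
-/

noncomputable section

open CategoryTheory CategoryTheory.Limits AlgebraicGeometry TopologicalSpace

namespace Literature.AlgebraicGeometry.Resolution

universe u

open Scheme.IdealSheafData

variable {X Y T : Scheme.{u}}

/-! ## `V(I)` is reduced iff `I` is radical -/

/-- **`V(I)` is reduced iff all the ideals `I(U)`, `U` affine, are radical** — `V(I)` is covered
by the affine schemes `Spec (Γ(X, U)/I(U))` (Mathlib `subschemeCover`), and `Spec (A/𝔞)` is
reduced iff `𝔞` is radical. [cite: GortzWedhorn2020, Prop. 3.27 (1) (p. 101)] -/
theorem isReduced_subscheme_iff (I : X.IdealSheafData) :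
    IsReduced I.subscheme ↔ ∀ U : X.affineOpens, (I.ideal U).IsRadical := by
  rw [IsReduced.iff_of_openCover (X := I.subscheme) I.subschemeCover.openCover]
  change (∀ U : X.affineOpens, IsReduced (Spec (.of (Γ(X, U) ⧸ I.ideal U)))) ↔ _
  refine forall_congr' fun U => ?_
  rw [affine_isReduced_iff, ← Ideal.isRadical_iff_quotient_reduced]

/-- `V(I)` is reduced iff `I = √I`. [cite: GortzWedhorn2020, Prop. 3.27 (1) (p. 101)] -/
theorem isReduced_subscheme_iff_radical_eq (I : X.IdealSheafData) :
    IsReduced I.subscheme ↔ I.radical = I := by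
  rw [isReduced_subscheme_iff]
  constructor
  · intro h
    ext U : 2
    rw [radical_ideal]
    exact (h U).radical
  · intro h U
    rw [← Ideal.radical_eq_iff, ← radical_ideal, h]

/-! ## Base change of closed subschemes -/

/-- **The base change `V(I) ×_Y T` of `V(I) ↪ X → Y` along `g : T → Y` is reduced iff the
closed subscheme `V(I · 𝒪_{X ×_Y T})` of `X ×_Y T` is reduced**: the two are isomorphic,
`V(I) ×_Y T ≅ V(I) ×_X (X ×_Y T)` (pasting of pull-back squares) and
`V(I) ×_X P ≅ V(I · 𝒪_P)` (Görtz–Wedhorn I, (4.11), Example 4.36; Mathlib `comapIso`).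
[cite: GortzWedhorn2020, Section (4.11), Example 4.36 (p. 139)] -/
theorem isReduced_pullback_subschemeι_comp_iff (I : X.IdealSheafData) (f : X ⟶ Y) (g : T ⟶ Y) :
    IsReduced (pullback (I.subschemeι ≫ f) g) ↔
      IsReduced (I.comap (pullback.fst f g)).subscheme := by
  let e : (I.comap (pullback.fst f g)).subscheme ≅ pullback (I.subschemeι ≫ f) g :=
    I.comapIso (pullback.fst f g) ≪≫ pullbackSymmetry _ _ ≪≫ pullbackRightPullbackFstIso f g _
  exact ⟨fun _ => isReduced_of_isOpenImmersion e.hom, fun _ => isReduced_of_isOpenImmersion e.inv⟩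

/-- The scheme-theoretic fibre of `V(I) ↪ X → Y` at `y` is reduced iff the closed subscheme
`V(I · 𝒪_{X_y})` of the fibre `X_y` is reduced.
[cite: GortzWedhorn2020, Section (4.11), Example 4.36 (p. 139)] -/
theorem isReduced_fiber_subschemeι_comp_iff (I : X.IdealSheafData) (f : X ⟶ Y) (y : Y) :
    IsReduced ((I.subschemeι ≫ f).fiber y) ↔ IsReduced (I.comap (f.fiberι y)).subscheme :=
  isReduced_pullback_subschemeι_comp_iff I f (Y.fromSpecResidueField y)

/-! ## Ideal sheaves with disjoint supports -/

/-- **Ideal sheaves with disjoint supports are comaximal**: `supp (I + J) = supp I ∩ supp J = ∅`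
forces `I + J = 𝒪_X`. [folklore] -/
theorem sup_eq_top_of_disjoint_support {I J : X.IdealSheafData}
    (h : Disjoint (I.support : Set X) J.support) : I ⊔ J = ⊤ := by
  rw [← support_eq_bot_iff, support_sup]
  apply Closeds.ext
  rw [Closeds.coe_inf, Closeds.coe_bot]
  exact h.inter_eq

/-- The product of ideal sheaves with disjoint supports is their intersection (affine-locally
`𝔞𝔟 = 𝔞 ∩ 𝔟` for comaximal ideals). [folklore] -/
theorem mul_eq_inf_of_disjoint_support {I J : X.IdealSheafData}
    (h : Disjoint (I.support : Set X) J.support) : I * J = I ⊓ J := by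
  have htop := sup_eq_top_of_disjoint_support h
  ext U : 2
  rw [ideal_mul, Pi.mul_apply, ideal_inf, Pi.inf_apply]
  refine Ideal.mul_eq_inf_of_coprime ?_
  have := congrArg (fun K : X.IdealSheafData => K.ideal U) htop
  simpa [ideal_sup] using this

/-- **The product of two radical ideal sheaves with disjoint supports is radical.** [folklore] -/
theorem radical_mul_eq_self_of_disjoint_support {I J : X.IdealSheafData} (hI : I.radical = I)
    (hJ : J.radical = J) (h : Disjoint (I.support : Set X) J.support) :
    (I * J).radical = I * J := by
  rw [mul_eq_inf_of_disjoint_support h, radical_inf, hI, hJ]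

/-- The product of three radical ideal sheaves with pairwise disjoint supports is radical.
[folklore] -/
theorem radical_mul₃_eq_self_of_disjoint_support {I J K : X.IdealSheafData} (hI : I.radical = I)
    (hJ : J.radical = J) (hK : K.radical = K) (hIJ : Disjoint (I.support : Set X) J.support)
    (hIK : Disjoint (I.support : Set X) K.support) (hJK : Disjoint (J.support : Set X) K.support) :
    (I * J * K).radical = I * J * K := by
  have hIJ' := radical_mul_eq_self_of_disjoint_support hI hJ hIJ
  refine radical_mul_eq_self_of_disjoint_support hIJ' hK ?_
  rw [support_mul, Closeds.coe_sup, Set.disjoint_union_left]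
  exact ⟨hIK, hJK⟩

/-! ## Reduced base change of a union of three closed subschemes -/

/-- Disjointness of supports over the image of `p : P → X` gives disjointness of the supports of
the inverse image ideal sheaves `I · 𝒪_P`, `J · 𝒪_P` (these are the preimages). [folklore] -/
theorem disjoint_support_comap {P : Scheme.{u}} (p : P ⟶ X) {I J : X.IdealSheafData}
    (h : Disjoint ((I.support : Set X) ∩ Set.range p) ((J.support : Set X) ∩ Set.range p)) :
    Disjoint ((I.comap p).support : Set P) (J.comap p).support := by
  rw [support_comap, support_comap, Closeds.coe_preimage, Closeds.coe_preimage]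
  refine Set.disjoint_left.mpr fun z hzI hzJ => ?_
  exact Set.disjoint_left.mp h ⟨hzI, z, rfl⟩ ⟨hzJ, z, rfl⟩

/-- **Reduced base change of a union of three closed subschemes with disjoint supports.** Let
`V(I₁)`, `V(I₂)`, `V(I₃)` be closed subschemes of `X`, `f : X → Y`, `g : T → Y`, such that the
base changes `V(I_j) ×_Y T` are reduced and the supports of the `I_j` are pairwise disjoint over
the image of `X ×_Y T → X`. Then `V(I₁ I₂ I₃) ×_Y T` is reduced: it is `V(J₁ J₂ J₃)` for the
inverse image ideals `J_j` on `X ×_Y T`, which are radical with pairwise disjoint supports.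
[folklore] -/
theorem isReduced_pullback_subschemeι_mul₃ (I₁ I₂ I₃ : X.IdealSheafData) (f : X ⟶ Y)
    (g : T ⟶ Y)
    (h₁₂ : Disjoint ((I₁.support : Set X) ∩ Set.range (pullback.fst f g))
      ((I₂.support : Set X) ∩ Set.range (pullback.fst f g)))
    (h₁₃ : Disjoint ((I₁.support : Set X) ∩ Set.range (pullback.fst f g))
      ((I₃.support : Set X) ∩ Set.range (pullback.fst f g)))
    (h₂₃ : Disjoint ((I₂.support : Set X) ∩ Set.range (pullback.fst f g))
      ((I₃.support : Set X) ∩ Set.range (pullback.fst f g)))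
    (hr₁ : IsReduced (pullback (I₁.subschemeι ≫ f) g))
    (hr₂ : IsReduced (pullback (I₂.subschemeι ≫ f) g))
    (hr₃ : IsReduced (pullback (I₃.subschemeι ≫ f) g)) :
    IsReduced (pullback ((I₁ * I₂ * I₃).subschemeι ≫ f) g) := by
  set p := pullback.fst f g with hp
  rw [isReduced_pullback_subschemeι_comp_iff, isReduced_subscheme_iff_radical_eq] at hr₁ hr₂ hr₃ ⊢
  rw [comap_mul, comap_mul]
  exact radical_mul₃_eq_self_of_disjoint_support hr₁ hr₂ hr₃ (disjoint_support_comap p h₁₂)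
    (disjoint_support_comap p h₁₃) (disjoint_support_comap p h₂₃)

/-- The range of the fibre inclusion `X_y → X` is `f⁻¹(y)`, so a subset of `X` meets it inside
`f⁻¹(y)`. [folklore] -/
theorem inter_range_fiberι (f : X ⟶ Y) (y : Y) (S : Set X) :
    S ∩ Set.range (f.fiberι y) = S ∩ f ⁻¹' {y} := by
  rw [Scheme.Hom.range_fiberι]

/-- **The scheme-theoretic fibre at `y` of the union `V(I₁ I₂ I₃) → Y` of three closed
subschemes of `X` is reduced** as soon as the three fibres `V(I_j)_y` are reduced and the
supports are pairwise disjoint on `f⁻¹(y)` (de Jong 1996, proof of 4.13: the hyperplane section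
`H = X ∩ H'` with "`H ∩ f⁻¹(y)` is a reduced scheme", for `H'` a union of transversal
hypersurfaces meeting `f⁻¹(y)` in disjoint sets). [folklore] -/
theorem isReduced_fiber_subschemeι_mul₃ (I₁ I₂ I₃ : X.IdealSheafData) (f : X ⟶ Y) (y : Y)
    (h₁₂ : Disjoint ((I₁.support : Set X) ∩ f ⁻¹' {y}) ((I₂.support : Set X) ∩ f ⁻¹' {y}))
    (h₁₃ : Disjoint ((I₁.support : Set X) ∩ f ⁻¹' {y}) ((I₃.support : Set X) ∩ f ⁻¹' {y}))
    (h₂₃ : Disjoint ((I₂.support : Set X) ∩ f ⁻¹' {y}) ((I₃.support : Set X) ∩ f ⁻¹' {y}))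
    (hr₁ : IsReduced ((I₁.subschemeι ≫ f).fiber y)) (hr₂ : IsReduced ((I₂.subschemeι ≫ f).fiber y))
    (hr₃ : IsReduced ((I₃.subschemeι ≫ f).fiber y)) :
    IsReduced (((I₁ * I₂ * I₃).subschemeι ≫ f).fiber y) := by
  have e : Set.range (pullback.fst f (Y.fromSpecResidueField y)) = f ⁻¹' {y} :=
    Scheme.Hom.range_fiberι f y
  refine isReduced_pullback_subschemeι_mul₃ I₁ I₂ I₃ f (Y.fromSpecResidueField y) ?_ ?_ ?_
    hr₁ hr₂ hr₃
  · rwa [e]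
  · rwa [e]
  · rwa [e]

end Literature.AlgebraicGeometry.Resolution

end
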